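import Literature.Analysis.FluidPDE.DeRosaPertCorrector
import Literature.Analysis.FluidPDE.DeRosaPertTransportIdentity
import HarnessLib

/-!
# De Rosa's perturbation stage: `D_t` of the potential summand (lift, cut-off factor, envelope)

Second file of the Calderón–Zygmund route to the transport error (see
`DeRosaPertTransportIdentity.lean` for the identities and the plan). Here, under the core
hypotheses `DeRosa.CoreHypotheses` of the De Rosa port (BDSV (2.17)–(2.20) without the
Euler–Reynolds equation), we prepare the ORDER-ONE ENVELOPE (`BDSV.HasEnvelope`,
`OnsagerBDSVEnvelope.lean`) of the lift of `D_t` of the `i`-th summand of the potential `Z`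
(BDSV (5.28)), from the three-term formula
`D_t(ρ_{q,i}^{1/2} ∇Φ_iᵀ V) = (D_tρ_{q,i}^{1/2}) ∇Φ_iᵀ V + ρ_{q,i}^{1/2} (D_t∇Φ_i)ᵀ V + ρ_{q,i}^{1/2} ∇Φ_iᵀ ∂_RV[D_tR̃_{q,i}]`
(`DeRosa.advectiveDeriv_potentialSummand`):

* the lift identity expressing it through the carrier objects of
  `OnsagerBDSVIncrementLeibniz.lean` (`BDSV.gradPhiCL`, `BDSV.stressCL`, `BDSV.mikadoLiftCL`,
  `BDSV.transposeCL`);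
* the cut-off amplitude: `ρ_{q,i}^{1/2} = θ(t) η_i` with `θ = (ρ_q/Σ∫η_j²)^{1/2}`, the derivative of
  `Σ_j ∫ η_j²` within `[0,T]` and its bound `≲ τ_q⁻¹` (Lemma 5.3 (iv)/(5.14): two active cut-offs,
  `|∂ₜη_j| ≤ C(1,0)τ⁻¹`), and `D_t ρ_{q,i}^{1/2} = θ' η_i + θ D_t η_i`;
* the vanishing of `D_t` of the `i`-th summand at interior times at which `η_i ≡ 0`.

## References

* L. De Rosa, Comm. PDE 44 (2019) 335–365 = arXiv:1801.10235, §5.5 Prop. 5.13 (`R̊^E`).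
* T. Buckmaster, C. De Lellis, L. Székelyhidi Jr., V. Vicol, CPAM 72 (2019) = arXiv:1701.08678,
  §6.1.2 (arXiv (6.6)–(6.8)), §5.2 (Lemma 5.3), §5.3 (5.28).
-/

open MeasureTheory Set
open scoped NNReal ENNReal ContDiff Matrix Matrix.Norms.Elementwise

noncomputable section

set_option maxSynthPendingDepth 3

namespace Literature.Analysis.FluidPDE

namespace DeRosa

open BDSV FunctionSpaces FunctionSpaces.Torus

/-- The flat three-torus `T³ = (ℝ/ℤ)³`, local notation. -/
local notation "𝕋³" => UnitAddTorus (Fin 3)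

/-- Euclidean `ℝ³`, local notation. -/
local notation "ℝ³" => EuclideanSpace ℝ (Fin 3)

/-- Real `3 × 3` matrices (elementwise norm), local notation. -/
local notation "𝕄" => Matrix (Fin 3) (Fin 3) ℝ

/-- The carrier `𝕃 = ℝ³ →L ℝ³`, local notation. -/
local notation "𝕃" => (EuclideanSpace ℝ (Fin 3) →L[ℝ] EuclideanSpace ℝ (Fin 3))

/-- `3 × 3` real arrays with the sup norm (the normed carrier of matrix-valued data), local notation. -/
local notation "𝕄π" => (Fin 3 → Fin 3 → ℝ)

/-! ## Carrier identities -/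

section Carrier

/-- `matCL` as a continuous linear map on arrays (sup norm) `𝕄π →L 𝕃`. [folklore] -/
def matCLM : 𝕄π →L[ℝ] 𝕃 := LinearMap.toContinuousLinearMap matCL.toAlgEquiv.toLinearMap

/-- `matCLM A = matCL A`. [folklore] -/
@[simp] theorem matCLM_apply (A : 𝕄) : matCLM A = matCL A := rfl

/-- `bmat A u = transposeCL (matCL A) u` (both are `Aᵀu`). [folklore] -/
theorem bmat_eq_transposeCL (A : 𝕄) (u : ℝ³) : bmat A u = transposeCL (matCL A) u := by
  rw [transposeCL_apply, matCL.symm_apply_apply, matCL_apply, bmat_apply]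

/-- `matCL (∇Φ_i(t)(proj y)) = gradPhiCL (D_i t) y` for a `C¹` displacement slice. [folklore] -/
theorem matCL_gradPhi {D : ℕ → ℝ → 𝕋³ → ℝ³} {i : ℕ} {t : ℝ} (hD : IsContDiff 1 (D i t)) (y : ℝ³) :
    matCL (gradPhi D i t (proj y)) = gradPhiCL (D i t) y := by
  have h := congrFun (lift_gradPhi (D := D) (i := i) (t := t) hD) y
  rw [lift_apply] at h
  rw [h, ← matCL_symm_gradPhiCL, matCL.apply_symm_apply]

variable {P : Params} {S : Setting} {η : ℕ → ℝ → 𝕋³ → ℝ} {D : ℕ → ℝ → 𝕋³ → ℝ³}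

/-- `matCL (R̃_{q,i}(t)(proj y)) = stressCL c (R̊̄_q t) (D_i t) y`, `c = Σ∫η_j²/ρ_q`. [folklore] -/
theorem matCL_tildeR {i : ℕ} {t : ℝ} (hD : IsContDiff 1 (D i t)) (y : ℝ³) :
    matCL (tildeR P S η D i t (proj y)) = stressCL (etaMass P S η t / rhoQ P S t) (S.Rbar t) (D i t) y := by
  have h := congrFun (lift_tildeR (P := P) (S := S) (η := η) (D := D) (i := i) (t := t) hD) y
  rw [lift_apply] at h
  rw [h, ← matCL_symm_stressCL, matCL.apply_symm_apply]

/-- The lifted pair `p(y) = (R̃, n(y + D(y)))` of the `i`-th summand at time `t`. [folklore] -/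
def pairPt (P : Params) (S : Setting) (η : ℕ → ℝ → 𝕋³ → ℝ) (D : ℕ → ℝ → 𝕋³ → ℝ³) (i : ℕ) (t : ℝ)
    (y : ℝ³) : 𝕃 × ℝ³ :=
  (stressCL (etaMass P S η t / rhoQ P S t) (S.Rbar t) (D i t) y,
    (P.freqNat (S.q + 1) : ℝ) • (y + lift (D i t) y))

/-- **The Mikado factor in the carrier**: `V(R̃_{q,i}, nΦ_i)(proj y) = mikadoLiftCL V (p(y))`.
[folklore] -/
theorem mikadoFactor_proj (𝔚 : MikadoDatum mikadoRadius) {i : ℕ} {t : ℝ} (hD : IsContDiff 1 (D i t))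
    (y : ℝ³) :
    mikadoFactor P S 𝔚 η D i t (proj y) = mikadoLiftCL 𝔚.V (pairPt P S η D i t y) := by
  rw [mikadoFactor, pairPt, mikadoLiftCL_apply, mikadoLift_apply, ← matCL_tildeR hD, matCL.symm_apply_apply,
    phiPoint, ← lift_apply (D i t) y, ← proj_add, Nat.cast_smul_eq_nsmul, proj_nsmul]

/-- **`∂_R V` in the carrier**: `∂_RV(R̃_{q,i}, nΦ_i)(proj y)[M] = D(mikadoLiftCL V)(p(y))[(matCL M, 0)]`
(both are the derivative at `0` of `s ↦ V(R̃ + sM, nΦ_i)`). [folklore] -/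
theorem mikadoRDeriv_proj (𝔚 : MikadoDatum mikadoRadius) {i : ℕ} {t : ℝ} (hD : IsContDiff 1 (D i t))
    (y : ℝ³) (M : 𝕄) :
    mikadoRDeriv P S 𝔚 η D i t (proj y) M =
      (fderiv ℝ (mikadoLiftCL 𝔚.V) (pairPt P S η D i t y)) (matCL M, 0) := by
  set ξ : ℝ³ := (P.freqNat (S.q + 1) : ℝ) • (y + lift (D i t) y) with hξ
  set R₀ : 𝕄 := tildeR P S η D i t (proj y) with hR₀
  have hph : (P.freqNat (S.q + 1) • phiPoint D i t (proj y) : 𝕋³) = proj ξ := by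
    rw [phiPoint, ← lift_apply (D i t) y, ← proj_add, hξ, Nat.cast_smul_eq_nsmul, proj_nsmul]
  have hp : pairPt P S η D i t y = (matCL R₀, ξ) := by
    rw [pairPt, hR₀, matCL_tildeR hD]
  -- the outer function on `𝕄` and its derivative
  set F : 𝕄 → ℝ³ := fun R' => 𝔚.V R' (P.freqNat (S.q + 1) • phiPoint D i t (proj y)) with hF
  have hV : ContDiff ℝ ∞ (mikadoLiftCL 𝔚.V) := contDiff_mikadoLiftCL 𝔚.contDiff_mikadoLift_V
  have hFeq : ∀ R' : 𝕄, F R' = mikadoLiftCL 𝔚.V (matCL R', ξ) := fun R' => by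
    rw [hF, mikadoLiftCL_apply, mikadoLift_apply, matCL.symm_apply_apply, hph]
  have hFd : DifferentiableAt ℝ F R₀ := by
    have h1 : ContDiff ℝ ∞ F := by
      have e : F = fun R' => mikadoLift 𝔚.V (R', ξ) := by
        funext R'; rw [hF, mikadoLift_apply, hph]
      rw [e]
      exact 𝔚.contDiff_mikadoLift_V.comp (contDiff_id.prodMk contDiff_const)
    exact (h1.differentiable (by simp)) R₀
  -- the curve `s ↦ R₀ + s • M` and the two chain rules
  have hγ : HasDerivAt (fun s : ℝ => R₀ + s • M) M 0 := by
    have h : HasDerivAt (fun s : ℝ => R₀ + s • M) ((1 : ℝ) • M) 0 :=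
      ((hasDerivAt_id (0 : ℝ)).smul_const M).const_add R₀
    rwa [one_smul] at h
  have h1 : HasDerivAt (fun s : ℝ => F (R₀ + s • M)) (fderiv ℝ F R₀ M) 0 := by
    have hpt : R₀ + (0 : ℝ) • M = R₀ := by rw [zero_smul, add_zero]
    have hFd' : HasFDerivAt F (fderiv ℝ F R₀) (R₀ + (0 : ℝ) • M) := by rw [hpt]; exact hFd.hasFDerivAt
    exact (hFd'.comp_hasDerivAt (0 : ℝ) hγ :)
  have hδ : HasDerivAt (fun s : ℝ => ((matCL R₀ + s • matCL M : 𝕃), ξ)) ((matCL M, 0) : 𝕃 × ℝ³) 0 := by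
    have ha : HasDerivAt (fun s : ℝ => (matCL R₀ + s • matCL M : 𝕃)) (matCL M) 0 := by
      have h : HasDerivAt (fun s : ℝ => (matCL R₀ + s • matCL M : 𝕃)) ((1 : ℝ) • matCL M) 0 :=
        ((hasDerivAt_id (0 : ℝ)).smul_const (matCL M)).const_add (matCL R₀)
      rwa [one_smul] at h
    exact ha.prodMk (hasDerivAt_const 0 ξ)
  have hVd : HasFDerivAt (mikadoLiftCL 𝔚.V) (fderiv ℝ (mikadoLiftCL 𝔚.V) (matCL R₀, ξ)) (matCL R₀, ξ) :=
    ((hV.differentiable (by simp)) _).hasFDerivAt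
  have h2 : HasDerivAt (fun s : ℝ => mikadoLiftCL 𝔚.V ((matCL R₀ + s • matCL M : 𝕃), ξ))
      ((fderiv ℝ (mikadoLiftCL 𝔚.V) (matCL R₀, ξ)) (matCL M, 0)) 0 := by
    have hpt : ((matCL R₀ + (0 : ℝ) • matCL M : 𝕃), ξ) = (matCL R₀, ξ) := by rw [zero_smul, add_zero]
    have hVd' : HasFDerivAt (mikadoLiftCL 𝔚.V) (fderiv ℝ (mikadoLiftCL 𝔚.V) (matCL R₀, ξ))
        ((matCL R₀ + (0 : ℝ) • matCL M : 𝕃), ξ) := by rw [hpt]; exact hVd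
    exact (hVd'.comp_hasDerivAt (0 : ℝ) hδ :)
  -- the two curves coincide
  have hcurve : (fun s : ℝ => F (R₀ + s • M)) = fun s => mikadoLiftCL 𝔚.V ((matCL R₀ + s • matCL M : 𝕃), ξ) := by
    funext s
    rw [hFeq, map_add, map_smul]
  rw [hcurve] at h1
  have heq := h1.unique h2
  rw [mikadoRDeriv, hp, ← heq]

/-- **The lift of `D_t` of the `i`-th summand in the carrier** (the three-term formula of
`DeRosa.advectiveDeriv_potentialSummand`, lifted to `ℝ³`). [cite: BuckmasterEtAl2018, §6.1.2 (arXiv (6.6)–(6.7))] -/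
theorem lift_advectiveDeriv_potentialSummand (h : SmoothData P S η D) (𝔚 : MikadoDatum mikadoRadius)
    (i : ℕ) {t : ℝ} (ht : t ∈ Icc 0 S.T)
    (htr : ∀ x, Torus.timeDerivWithin (Icc 0 S.T) (D i) t x + Torus.convect (S.vbar t) (D i t) x + S.vbar t x = 0)
    (y : ℝ³) :
    lift (advectiveDeriv S.T S.vbar (potentialSummand P S 𝔚 η D i) t) y =
      lift (advectiveDeriv S.T S.vbar (sqrtRhoI P S η i) t) y •
          transposeCL (gradPhiCL (D i t) y) (mikadoLiftCL 𝔚.V (pairPt P S η D i t y)) +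
        lift (sqrtRhoI P S η i t) y •
          (transposeCL (matCL (lift (advectiveDeriv S.T S.vbar (gradPhi D i) t) y))
              (mikadoLiftCL 𝔚.V (pairPt P S η D i t y)) +
            transposeCL (gradPhiCL (D i t) y)
              ((fderiv ℝ (mikadoLiftCL 𝔚.V) (pairPt P S η D i t y))
                (matCL (lift (advectiveDeriv S.T S.vbar (tildeR P S η D i) t) y), 0))) := by
  have hD1 : IsContDiff 1 (D i t) := ((h.disp i).isSmooth_slice ht).isContDiff (by simp)
  rw [lift_apply, advectiveDeriv_potentialSummand h 𝔚 i ht (proj y) (htr (proj y)), lift_apply, lift_apply,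
    lift_apply, lift_apply, bmat_eq_transposeCL, bmat_eq_transposeCL, bmat_eq_transposeCL, matCL_gradPhi hD1,
    mikadoFactor_proj 𝔚 hD1, mikadoRDeriv_proj 𝔚 hD1]

end Carrier

/-! ## The cut-off amplitude `ρ_{q,i}^{1/2} = θ(t) η_i` -/

section Amplitude

variable {P : Params} {S : Setting} {Nbar : ℕ} {Cin C₀ c₀ : ℝ} {Cη : ℕ → ℕ → ℝ}
  {η : ℕ → ℝ → 𝕋³ → ℝ} {D : ℕ → ℝ → 𝕋³ → ℝ³}

/-- `θ(t) = (ρ_q(t)/Σ_j∫η_j²(t))^{1/2}`, the time factor of `ρ_{q,i}^{1/2} = θ η_i`. [cite: BuckmasterEtAl2018, §5.2 (ρ_{q,i})] -/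
def thetaFn (P : Params) (S : Setting) (η : ℕ → ℝ → 𝕋³ → ℝ) (t : ℝ) : ℝ :=
  Real.sqrt (rhoQ P S t / etaMass P S η t)

/-- `ρ_{q,i}^{1/2} = θ • η_i`. [folklore] -/
theorem sqrtRhoI_eq (η : ℕ → ℝ → 𝕋³ → ℝ) (i : ℕ) :
    sqrtRhoI P S η i = fun s y => thetaFn P S η s • η i s y := by
  funext s y
  rw [sqrtRhoI, thetaFn, smul_eq_mul, mul_comm]

/-- **`|∂ₜη_j| ≤ max(C(1,0),0) τ⁻¹`** pointwise on `[0,T]` (Lemma 5.3, arXiv (5.14), `n = 1`, `m = 0`).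
[cite: BuckmasterEtAl2018, Lemma 5.3 (arXiv (5.14))] -/
theorem PerturbationData.abs_timeDerivWithin_eta_le (𝒟 : PerturbationData P S c₀ Cη) (ha : 1 ≤ P.a)
    (j : ℕ) {t : ℝ} (ht : t ∈ Icc 0 S.T) (x : 𝕋³) :
    |Torus.timeDerivWithin (Icc 0 S.T) (𝒟.cut.η j) t x| ≤ max (Cη 1 0) 0 * (P.τ S.q)⁻¹ := by
  have hτ : 0 < P.τ S.q := glueScale_pos ha S.q
  have h := 𝒟.cut.deriv_le j 1 0
  simp only [Function.iterate_one, Nat.cast_one] at h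
  have hB : 0 ≤ max (Cη 1 0) 0 * (P.τ S.q)⁻¹ := mul_nonneg (le_max_right _ _) (inv_nonneg.2 hτ.le)
  have h' : HolderSupLE S.T (Torus.timeDerivWithin (Icc 0 S.T) (𝒟.cut.η j)) 0 0 (max (Cη 1 0) 0 * (P.τ S.q)⁻¹) := by
    refine h.mono ?_
    rw [Real.rpow_neg_one]
    exact mul_le_mul_of_nonneg_right (le_max_left _ _) (inv_nonneg.2 hτ.le)
  have hsup := HolderSupLE.supLE_of_zero h' hB t ht x
  rwa [Real.norm_eq_abs] at hsup

/-- **The derivative of `Σ_j ∫ η_j²` within `[0,T]`** exists and is bounded by `4 max(C(1,0),0) τ⁻¹`: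
`(∫η_j²)' = ∫ 2η_j∂ₜη_j` vanishes unless `η_j(t,·) ≢ 0`, at most two cut-offs are active at any time
(property (iv)), `0 ≤ η_j ≤ 1` and `|∂ₜη_j| ≤ C(1,0)τ⁻¹`. [cite: BuckmasterEtAl2018, Lemma 5.3 (arXiv (5.14)) and §5.2 (iv)] -/
theorem PerturbationData.hasDerivWithinAt_etaMass (𝒟 : PerturbationData P S c₀ Cη) (hT : 0 < S.T)
    (ha : 1 ≤ P.a) {t : ℝ} (ht : t ∈ Icc 0 S.T) :
    ∃ m' : ℝ, HasDerivWithinAt (etaMass P S 𝒟.cut.η) m' (Icc 0 S.T) t ∧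
      |m'| ≤ 4 * (max (Cη 1 0) 0 * (P.τ S.q)⁻¹) := by
  have hτ : 0 < P.τ S.q := glueScale_pos ha S.q
  set K : ℝ := max (Cη 1 0) 0 * (P.τ S.q)⁻¹ with hK
  have hK0 : 0 ≤ K := mul_nonneg (le_max_right _ _) (inv_nonneg.2 hτ.le)
  -- one cut-off
  set g : ℕ → ℝ := fun j => ∫ x, 2 * 𝒟.cut.η j t x * Torus.timeDerivWithin (Icc 0 S.T) (𝒟.cut.η j) t x with hg
  have hderiv : ∀ j, HasDerivWithinAt (fun s => ∫ x, 𝒟.cut.η j s x ^ 2) (g j) (Icc 0 S.T) t := by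
    intro j
    have hsq : Torus.IsSmoothSpaceTimeOn (Icc 0 S.T) (fun s x => 𝒟.cut.η j s x ^ 2) := by
      have h := (𝒟.cut.smooth j).mul (𝒟.cut.smooth j)
      refine ContDiffOn.congr h ?_
      rintro ⟨s, y⟩ _
      simp only [stLift_apply, pow_two]
    have h0 := hsq.hasDerivWithinAt_integral (convex_Icc 0 S.T) ht
    have hslice : ∀ x, Torus.timeDerivWithin (Icc 0 S.T) (fun s x => 𝒟.cut.η j s x ^ 2) t x =
        2 * 𝒟.cut.η j t x * Torus.timeDerivWithin (Icc 0 S.T) (𝒟.cut.η j) t x := by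
      intro x
      have h1 := (𝒟.cut.smooth j).hasDerivWithinAt_slice ht x
      have h2 : HasDerivWithinAt (fun s => 𝒟.cut.η j s x ^ 2)
          ((2 : ℕ) * 𝒟.cut.η j t x ^ (2 - 1) * Torus.timeDerivWithin (Icc 0 S.T) (𝒟.cut.η j) t x)
          (Icc 0 S.T) t := h1.pow 2
      unfold Torus.timeDerivWithin
      rw [h2.derivWithin (uniqueDiffOn_Icc hT t ht)]
      simp [Torus.timeDerivWithin]
    have e : (∫ x, Torus.timeDerivWithin (Icc 0 S.T) (fun s x => 𝒟.cut.η j s x ^ 2) t x) = g j := by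
      rw [hg]
      exact integral_congr_ae (Filter.Eventually.of_forall hslice)
    rw [← e]
    exact h0
  -- the bound on one cut-off, and vanishing for inactive ones
  have hgb : ∀ j, |g j| ≤ 2 * K := by
    intro j
    have hpt : ∀ x, ‖2 * 𝒟.cut.η j t x * Torus.timeDerivWithin (Icc 0 S.T) (𝒟.cut.η j) t x‖ ≤ 2 * K := by
      intro x
      rw [Real.norm_eq_abs, abs_mul, abs_mul, abs_two]
      have h1 : |𝒟.cut.η j t x| ≤ 1 := by
        rw [abs_of_nonneg (𝒟.cut.nonneg j t x)]; exact 𝒟.cut.le_one j t x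
      have h2 := 𝒟.abs_timeDerivWithin_eta_le ha j ht x
      calc 2 * |𝒟.cut.η j t x| * |Torus.timeDerivWithin (Icc 0 S.T) (𝒟.cut.η j) t x|
          ≤ 2 * 1 * K := by gcongr
        _ = 2 * K := by ring
    have h := norm_integral_le_of_norm_le_const (μ := (volume : Measure 𝕋³)) (Filter.Eventually.of_forall hpt)
    rw [Real.norm_eq_abs] at h
    simpa using h
  have hgz : ∀ j, (∀ x, 𝒟.cut.η j t x = 0) → g j = 0 := by
    intro j hj
    rw [hg]
    simp [hj]
  refine ⟨∑ j ∈ Finset.range (cutoffCount S.T (P.τ S.q)), g j, ?_, ?_⟩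
  · have e : etaMass P S 𝒟.cut.η = fun s => ∑ j ∈ Finset.range (cutoffCount S.T (P.τ S.q)), ∫ x, 𝒟.cut.η j s x ^ 2 := by
      funext s; rfl
    rw [e]
    exact HasDerivWithinAt.fun_sum fun j _ => hderiv j
  · refine (Finset.abs_sum_le_sum_abs _ _).trans ?_
    have h := 𝒟.cut.sum_le_two_mul hτ t (g := fun j => |g j|) (M := 2 * K) (by positivity) hgb
      (fun j hj => by show |g j| = 0; rw [hgz j hj, abs_zero]) (Finset.range (cutoffCount S.T (P.τ S.q)))
    linarith

/-- **`D_t ρ_{q,i}^{1/2} = θ' η_i + θ D_t η_i`** on `[0,T]`, for any one-sided derivative `θ'` of `θ`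
within `[0,T]` at `t`. [cite: BuckmasterEtAl2018, Prop. 5.9 (proof, (5.41): differentiating the amplitudes)] -/
theorem advectiveDeriv_sqrtRhoI (h : SmoothData P S η D) (i : ℕ) {t : ℝ} (ht : t ∈ Icc 0 S.T) {θ' : ℝ}
    (hθ : HasDerivWithinAt (thetaFn P S η) θ' (Icc 0 S.T) t) (x : 𝕋³) :
    advectiveDeriv S.T S.vbar (sqrtRhoI P S η i) t x =
      θ' * η i t x + thetaFn P S η t * advectiveDeriv S.T S.vbar (η i) t x := by
  rw [sqrtRhoI_eq, advectiveDeriv_time_smul h.pos_T ht hθ (h.eta i) x, smul_eq_mul, smul_eq_mul]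

/-- The bound `Θ'` on `|θ'|`: with `ρ_D` the bound of `CoreHypotheses.abs_rhoQDeriv_le` on `|ρ_q'|`,
`M_m = 4 max(C(1,0),0) τ⁻¹` the bound on `|(Σ∫η_j²)'|`, `ρ_min = δ_{q+1}λ_q^{-α}/8 ≤ ρ_q`, `c₀ ≤ Σ∫η_j² ≤ 1`
and `ρ_q ≤ δ_{q+1}`: `|θ'| ≤ (ρ_D + δ_{q+1} M_m) / c₀² / (2 ρ_min^{1/2})`. [folklore] -/
def thetaDerivBound (P : Params) (S : Setting) (Cin c₀ : ℝ) (Cη : ℕ → ℕ → ℝ) : ℝ :=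
  ((1 + 6 * (Cin * (amp P.β P.a P.b (S.q + 1) * mollScale P.β P.α P.a P.b S.q ^ P.α)) *
        (Cin * (Real.sqrt (amp P.β P.a P.b S.q) * freq P.a P.b S.q))) / 3 +
      amp P.β P.a P.b (S.q + 1) * (4 * (max (Cη 1 0) 0 * (P.τ S.q)⁻¹))) / c₀ ^ 2 /
    (2 * Real.sqrt (amp P.β P.a P.b (S.q + 1) * freq P.a P.b S.q ^ (-P.α) / 8))

/-- `Θ' ≥ 0` for `C_in ≥ 0`, `c₀ > 0`, `a ≥ 1`. [folklore] -/
theorem thetaDerivBound_nonneg (hCin : 0 ≤ Cin) (ha : 1 ≤ P.a) :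
    0 ≤ thetaDerivBound P S Cin c₀ Cη := by
  unfold thetaDerivBound
  have hδ := (amp_pos (β := P.β) (b := P.b) ha (S.q + 1)).le
  have hℓ := (mollScale_pos (β := P.β) (α := P.α) (b := P.b) ha S.q).le
  have hτ : 0 < P.τ S.q := glueScale_pos ha S.q
  have hf := (freq_pos (b := P.b) ha S.q).le
  have hc : 0 ≤ c₀ ^ 2 := sq_nonneg _
  positivity

/-- **`θ` is differentiable within `[0,T]` with `|θ'| ≤ Θ'`** (`θ = (ρ_q/Σ∫η_j²)^{1/2}`; quotient and
chain rules with `CoreHypotheses.hasDerivWithinAt_rhoQ`, `PerturbationData.hasDerivWithinAt_etaMass`).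
[cite: BuckmasterEtAl2018, Prop. 5.9 (proof, (5.41))] -/
theorem CoreHypotheses.hasDerivWithinAt_thetaFn (H : CoreHypotheses P S Nbar Cin C₀)
    (𝒟 : PerturbationData P S c₀ Cη) (hc₀ : 0 < c₀) (hCin : 0 ≤ Cin) (ha : 1 ≤ P.a)
    (h4 : 4 * amp P.β P.a P.b (S.q + 2) ≤ amp P.β P.a P.b (S.q + 1) * freq P.a P.b S.q ^ (-P.α))
    {t : ℝ} (ht : t ∈ Icc 0 S.T) :
    ∃ θ' : ℝ, HasDerivWithinAt (thetaFn P S 𝒟.cut.η) θ' (Icc 0 S.T) t ∧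
      |θ'| ≤ thetaDerivBound P S Cin c₀ Cη := by
  have hT := H.pos_T
  set δ := amp P.β P.a P.b (S.q + 1) with hδdef
  set ρmin : ℝ := δ * freq P.a P.b S.q ^ (-P.α) / 8 with hρmin
  have hδ0 : 0 < δ := amp_pos ha _
  have hρmin0 : 0 < ρmin := div_pos (mul_pos hδ0 (Real.rpow_pos_of_pos (freq_pos ha _) _)) (by norm_num)
  -- `ρ`, `m` at `t`
  have hρlo : ρmin ≤ rhoQ P S t := H.le_rhoQ h4 ht
  have hρ0 : 0 < rhoQ P S t := hρmin0.trans_le hρlo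
  have hρhi : rhoQ P S t ≤ δ := H.rhoQ_le ha ht
  have hmlo : c₀ ≤ etaMass P S 𝒟.cut.η t := 𝒟.le_etaMass ht
  have hm0 : 0 < etaMass P S 𝒟.cut.η t := hc₀.trans_le hmlo
  have hmhi : etaMass P S 𝒟.cut.η t ≤ 1 := 𝒟.etaMass_le_one ht
  -- derivatives
  have hρd := H.hasDerivWithinAt_rhoQ ht
  obtain ⟨m', hmd, hm'⟩ := 𝒟.hasDerivWithinAt_etaMass hT ha ht
  have hud := hρd.div hmd hm0.ne'
  have hu0 : 0 < rhoQ P S t / etaMass P S 𝒟.cut.η t := div_pos hρ0 hm0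
  have hθd := hud.sqrt hu0.ne'
  refine ⟨_, hθd, ?_⟩
  -- the bound
  have hρD := H.abs_rhoQDeriv_le hCin ha ht
  set ρD := (1 + 6 * (Cin * (amp P.β P.a P.b (S.q + 1) * mollScale P.β P.α P.a P.b S.q ^ P.α)) *
    (Cin * (Real.sqrt (amp P.β P.a P.b S.q) * freq P.a P.b S.q))) / 3 with hρDdef
  set Mm : ℝ := 4 * (max (Cη 1 0) 0 * (P.τ S.q)⁻¹) with hMm
  have hρD0 : 0 ≤ ρD := (abs_nonneg _).trans hρD
  have hMm0 : 0 ≤ Mm := (abs_nonneg _).trans hm'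
  -- `|u'| ≤ (ρ_D + δ M_m)/c₀²`
  have hnum : |rhoQDeriv S t * etaMass P S 𝒟.cut.η t - rhoQ P S t * m'| ≤ ρD + δ * Mm := by
    refine (abs_sub _ _).trans (add_le_add ?_ ?_)
    · rw [abs_mul, abs_of_pos hm0]
      calc |rhoQDeriv S t| * etaMass P S 𝒟.cut.η t ≤ ρD * 1 :=
            mul_le_mul hρD hmhi hm0.le hρD0
        _ = ρD := mul_one _
    · rw [abs_mul, abs_of_pos hρ0]
      exact mul_le_mul hρhi hm' (abs_nonneg _) hδ0.le
  have hu' : |(rhoQDeriv S t * etaMass P S 𝒟.cut.η t - rhoQ P S t * m') / etaMass P S 𝒟.cut.η t ^ 2| ≤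
      (ρD + δ * Mm) / c₀ ^ 2 := by
    rw [abs_div, abs_of_pos (pow_pos hm0 2)]
    exact div_le_div₀ (add_nonneg hρD0 (mul_nonneg hδ0.le hMm0)) hnum (pow_pos hc₀ 2)
      (pow_le_pow_left₀ hc₀.le hmlo 2)
  -- `√u ≥ √ρ_min`
  have hsq : Real.sqrt ρmin ≤ Real.sqrt (rhoQ P S t / etaMass P S 𝒟.cut.η t) := by
    refine Real.sqrt_le_sqrt (hρlo.trans ?_)
    rw [le_div_iff₀ hm0]
    exact mul_le_of_le_one_right hρ0.le hmhi
  have hsq0 : 0 < Real.sqrt ρmin := Real.sqrt_pos.2 hρmin0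
  simp only [Pi.div_apply]
  rw [abs_div, abs_mul, abs_two, abs_of_pos (hsq0.trans_le hsq)]
  unfold thetaDerivBound
  rw [← hδdef, ← hρDdef, ← hMm, ← hρmin]
  exact div_le_div₀ (div_nonneg (add_nonneg hρD0 (mul_nonneg hδ0.le hMm0)) (sq_nonneg _)) hu'
    (mul_pos two_pos hsq0) (mul_le_mul_of_nonneg_left hsq zero_le_two)

end Amplitude

/-! ## Inactive cut-offs at interior times -/

section Inactive

variable {P : Params} {S : Setting} {η : ℕ → ℝ → 𝕋³ → ℝ} {D : ℕ → ℝ → 𝕋³ → ℝ³} {c₀ : ℝ}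
  {Cη : ℕ → ℕ → ℝ}

/-- At an interior time `t` at which `η_i(t, x) = 0`, `∂ₜη_i(t, x) = 0` (`η_i ≥ 0` has a minimum).
[folklore] -/
theorem PerturbationData.timeDerivWithin_eta_eq_zero (𝒟 : PerturbationData P S c₀ Cη) {i : ℕ} {t : ℝ}
    (ht : t ∈ Ioo 0 S.T) {x : 𝕋³} (hη : 𝒟.cut.η i t x = 0) :
    Torus.timeDerivWithin (Icc 0 S.T) (𝒟.cut.η i) t x = 0 := by
  have ht' : t ∈ Icc 0 S.T := Ioo_subset_Icc_self ht
  have hnhds : Icc 0 S.T ∈ nhds t := Icc_mem_nhds ht.1 ht.2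
  have h1 := ((𝒟.cut.smooth i).hasDerivWithinAt_slice ht' x).hasDerivAt hnhds
  have hmin : IsLocalMin (fun s => 𝒟.cut.η i s x) t :=
    Filter.Eventually.of_forall fun s => by
      show 𝒟.cut.η i t x ≤ 𝒟.cut.η i s x
      rw [hη]; exact 𝒟.cut.nonneg i s x
  exact hmin.hasDerivAt_eq_zero h1

/-- **`D_t` of the `i`-th summand vanishes at interior times at which `η_i ≡ 0`.** [folklore] -/
theorem PerturbationData.advectiveDeriv_potentialSummand_eq_zero (𝒟 : PerturbationData P S c₀ Cη)
    (h : SmoothData P S 𝒟.cut.η 𝒟.D) (𝔚 : MikadoDatum mikadoRadius) {i : ℕ} {t : ℝ} (ht : t ∈ Ioo 0 S.T)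
    (hη : ∀ x, 𝒟.cut.η i t x = 0) (x : 𝕋³) :
    advectiveDeriv S.T S.vbar (potentialSummand P S 𝔚 𝒟.cut.η 𝒟.D i) t x = 0 := by
  have ht' : t ∈ Icc 0 S.T := Ioo_subset_Icc_self ht
  have hT := h.pos_T
  -- the summand as `η_i • G` with `G` jointly smooth
  set G : ℝ → 𝕋³ → ℝ³ := fun s y => thetaFn P S 𝒟.cut.η s •
    bmat (gradPhi 𝒟.D i s y) (mikadoFactor P S 𝔚 𝒟.cut.η 𝒟.D i s y) with hG
  have e : potentialSummand P S 𝔚 𝒟.cut.η 𝒟.D i = fun s y => 𝒟.cut.η i s y • G s y := by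
    funext s y
    rw [potentialSummand_eq, hG, smul_smul]
    rfl
  rw [e, advectiveDeriv_apply]
  -- the slice at time `t` vanishes identically
  have hslice : (fun y => 𝒟.cut.η i t y • G t y) = fun _ => (0 : ℝ³) := by
    funext y; rw [hη y, zero_smul]
  have hsp : Torus.fderiv (fun y => 𝒟.cut.η i t y • G t y) x (S.vbar t x) = 0 := by
    rw [hslice]
    show (_root_.fderiv ℝ (fun _ : ℝ³ => (0 : ℝ³)) 0) (S.vbar t x) = 0
    simp
  -- the time derivative: `∂ₜη_i(t,x) = 0` and `η_i(t,x) = 0`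
  have hGd : DifferentiableWithinAt ℝ (fun s => G s x) (Icc 0 S.T) t := by
    have hsum := (h.potential 𝔚)
    -- `G s x = θ s • bmat (∇Φ) V`: smooth in `s` as the summand with `η` replaced by `1`; we use the
    -- smoothness of `θ` and of the matrix/Mikado factors
    have hθ : ContDiffOn ℝ ∞ (thetaFn P S 𝒟.cut.η) (Icc 0 S.T) := by
      have hρ := contDiffOn_rhoQ (P := P) (S := S) hT h.e h.vbar
      have hm := contDiffOn_etaMass (P := P) (S := S) hT h.eta
      refine ((hρ.div hm fun s hs => (h.mass_pos s hs).ne').sqrt fun s hs => ?_)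
      exact (div_pos (h.rho_pos s hs) (h.mass_pos s hs)).ne'
    have hF : Torus.IsSmoothSpaceTimeOn (Icc 0 S.T)
        (fun s y => bmat (gradPhi 𝒟.D i s y) (mikadoFactor P S 𝔚 𝒟.cut.η 𝒟.D i s y)) :=
      (h.gradPhi i).clm_bilinear (h.mikadoV 𝔚 i) bmat
    have hGs : Torus.IsSmoothSpaceTimeOn (Icc 0 S.T) G := (Torus.isSmoothSpaceTimeOn_of_time hθ).smul hF
    exact (hGs.hasDerivWithinAt_slice ht' x).differentiableWithinAt
  have hηd : HasDerivWithinAt (fun s => 𝒟.cut.η i s x) 0 (Icc 0 S.T) t := by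
    have h1 := (𝒟.cut.smooth i).hasDerivWithinAt_slice ht' x
    rwa [𝒟.timeDerivWithin_eta_eq_zero ht (hη x)] at h1
  have hprod := hηd.smul hGd.hasDerivWithinAt
  rw [hη x, zero_smul, zero_smul, add_zero] at hprod
  have htime : Torus.timeDerivWithin (Icc 0 S.T) (fun s y => 𝒟.cut.η i s y • G s y) t x = 0 := by
    unfold Torus.timeDerivWithin
    exact hprod.derivWithin (uniqueDiffOn_Icc hT t ht')
  rw [htime, hsp, add_zero]

end Inactive

/-! ## The abstract order-one envelope of `D_t` of the summand in the carrier -/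

section AbstractEnvelope

variable {V : 𝕄 → 𝕋³ → ℝ³} {c n : ℝ} {Rsl : 𝕋³ → Fin 3 → ℝ³} {Dsl : 𝕋³ → ℝ³}
  {σℓ dσ : ℝ³ → ℝ} {dA dR : ℝ³ → 𝕄π}

/-- Transport of an envelope along an equality of functions. [folklore] -/
theorem _root_.Literature.Analysis.FluidPDE.BDSV.HasEnvelope.of_eq {E F : Type*} [NormedAddCommGroup E]
    [NormedSpace ℝ E] [NormedAddCommGroup F] [NormedSpace ℝ F] {f g : E → F} {k : ℕ} {A μ : ℝ}
    (h : HasEnvelope f k A μ) (hfg : f = g) : HasEnvelope g k A μ := hfg ▸ h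

/-- The evaluation pairing `(w, L) ↦ L w` on `(𝕃 × ℝ³) × ((𝕃 × ℝ³) →L ℝ³)` has norm at most one.
[folklore] -/
theorem norm_apply₂_le :
    ‖(ContinuousLinearMap.apply ℝ ℝ³ : (𝕃 × ℝ³) →L[ℝ] ((𝕃 × ℝ³) →L[ℝ] ℝ³) →L[ℝ] ℝ³)‖ ≤ 1 := by
  rw [ContinuousLinearMap.apply, ContinuousLinearMap.opNorm_flip]
  exact ContinuousLinearMap.norm_id_le

/-- The amplitude arithmetic of `DeRosa.hasEnvelope_dtSummandCL`. [folklore] -/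
theorem dtSummand_amp_arith {θ CV Mn Ln Aσ Adσ AdA AdR a a' : ℝ} (hθ : 0 ≤ θ) (hCV : 0 ≤ CV)
    (hMn : 0 ≤ Mn) (hLn : 0 ≤ Ln) (hAσ : 0 ≤ Aσ) (hAdσ : 0 ≤ Adσ) (hAdA : 0 ≤ AdA) (hAdR : 0 ≤ AdR)
    (ha0 : 0 ≤ a) (_ha'0 : 0 ≤ a') (ha : a ≤ 1) (ha' : a' ≤ 1) :
    2 ^ 1 * Adσ * (a * 2 ^ 1 * CV * (θ * 2)) +
        2 ^ 1 * Aσ * (a * 2 ^ 1 * CV * (θ * (Mn * AdA)) + a * 2 ^ 1 * (a' * 2 ^ 1 * (Ln * AdR) * CV) * (θ * 2)) ≤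
      32 * θ * CV * (1 + Mn + Ln) * (Adσ + Aσ * (AdA + AdR)) := by
  have hθC : 0 ≤ θ * CV := mul_nonneg hθ hCV
  have t1 : 2 ^ 1 * Adσ * (a * 2 ^ 1 * CV * (θ * 2)) ≤ 32 * θ * CV * (1 + Mn + Ln) * Adσ := by
    have e : 2 ^ 1 * Adσ * (a * 2 ^ 1 * CV * (θ * 2)) = (8 * a) * ((θ * CV) * Adσ) := by ring
    have e' : 32 * θ * CV * (1 + Mn + Ln) * Adσ = (32 * (1 + Mn + Ln)) * ((θ * CV) * Adσ) := by ring
    rw [e, e']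
    exact mul_le_mul_of_nonneg_right (by nlinarith) (mul_nonneg hθC hAdσ)
  have t2 : a * 2 ^ 1 * CV * (θ * (Mn * AdA)) ≤ 16 * θ * CV * (1 + Mn + Ln) * AdA := by
    have e : a * 2 ^ 1 * CV * (θ * (Mn * AdA)) = (2 * a * Mn) * ((θ * CV) * AdA) := by ring
    have e' : 16 * θ * CV * (1 + Mn + Ln) * AdA = (16 * (1 + Mn + Ln)) * ((θ * CV) * AdA) := by ring
    rw [e, e']
    refine mul_le_mul_of_nonneg_right ?_ (mul_nonneg hθC hAdA)
    nlinarith [mul_le_of_le_one_left hMn ha]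
  have t3 : a * 2 ^ 1 * (a' * 2 ^ 1 * (Ln * AdR) * CV) * (θ * 2) ≤ 16 * θ * CV * (1 + Mn + Ln) * AdR := by
    have e : a * 2 ^ 1 * (a' * 2 ^ 1 * (Ln * AdR) * CV) * (θ * 2) = (8 * (a * a') * Ln) * ((θ * CV) * AdR) := by ring
    have e' : 16 * θ * CV * (1 + Mn + Ln) * AdR = (16 * (1 + Mn + Ln)) * ((θ * CV) * AdR) := by ring
    rw [e, e']
    refine mul_le_mul_of_nonneg_right ?_ (mul_nonneg hθC hAdR)
    have haa : a * a' ≤ 1 := by nlinarith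
    nlinarith [mul_le_of_le_one_left hLn haa, mul_nonneg ha0 _ha'0]
  have t23 : 2 ^ 1 * Aσ * (a * 2 ^ 1 * CV * (θ * (Mn * AdA)) + a * 2 ^ 1 * (a' * 2 ^ 1 * (Ln * AdR) * CV) * (θ * 2)) ≤
      32 * θ * CV * (1 + Mn + Ln) * (Aσ * (AdA + AdR)) := by
    have h := add_le_add t2 t3
    have e' : 32 * θ * CV * (1 + Mn + Ln) * (Aσ * (AdA + AdR)) =
        2 ^ 1 * Aσ * (16 * θ * CV * (1 + Mn + Ln) * AdA + 16 * θ * CV * (1 + Mn + Ln) * AdR) := by ring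
    rw [e']
    exact mul_le_mul_of_nonneg_left h (by positivity)
  have h := add_le_add t1 t23
  have e' : 32 * θ * CV * (1 + Mn + Ln) * (Adσ + Aσ * (AdA + AdR)) =
      32 * θ * CV * (1 + Mn + Ln) * Adσ + 32 * θ * CV * (1 + Mn + Ln) * (Aσ * (AdA + AdR)) := by ring
  rw [e']
  exact h

/-- **The order-one envelope of the lifted `D_t`-summand** (the abstract form). With
`T = transposeCL`, `G = ∇Φ`, `p = (R̃, n(y + D))`: if `‖DᵐV‖ ≤ C_V` on `K × ℝ³` (`m ≤ 2`),
`‖D(lift D)‖ ≤ 1`, `‖D²(lift D)‖ ≤ 2μ`, `R̃ ∈ K`, `‖DR̃‖ ≤ 2μ`, `|n| ≤ μ`, `1 ≤ μ`, and the four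
data `σ` (lift of `ρ_{q,i}^{1/2}`), `dσ` (lift of `D_tρ_{q,i}^{1/2}`), `dA` (lift of `D_t∇Φ_i`),
`dR` (lift of `D_tR̃_{q,i}`) have order-one envelopes `(A_σ, μ)`, `(A_{dσ}, μ)`, `(A_{dA}, μ)`,
`(A_{dR}, μ)`, then
`y ↦ dσ • T(G)(V∘p) + σ • (T(dA)(V∘p) + T(G)(DV(p)[(dR, 0)]))` has the order-one envelope
`(32 ‖T‖ C_V (1 + ‖matCLM‖ + ‖inl ∘ matCLM‖) (A_{dσ} + A_σ (A_{dA} + A_{dR})), 2μ)`.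
[cite: BuckmasterEtAl2018, §6.1.2 (arXiv (6.6)–(6.7)) with Cor. 5.8 (5.34)] -/
theorem hasEnvelope_dtSummandCL (hV : ContDiff ℝ ∞ (mikadoLift V)) {K : Set 𝕃} {CV : ℝ} (hCV0 : 0 ≤ CV)
    (hCV : ∀ m ≤ 2, ∀ S ∈ K, ∀ ξ : ℝ³, ‖iteratedFDeriv ℝ m (mikadoLiftCL V) (S, ξ)‖ ≤ CV)
    (hR : IsSmooth Rsl) (hD : IsSmooth Dsl) {μ Aσ Adσ AdA AdR : ℝ} (hμ : 1 ≤ μ) (hn : |n| ≤ μ)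
    (hd1 : ∀ y, ‖iteratedFDeriv ℝ 1 (lift Dsl) y‖ ≤ 1) (hd2 : ∀ y, ‖iteratedFDeriv ℝ 2 (lift Dsl) y‖ ≤ 2 * μ)
    (hK : ∀ y, stressCL c Rsl Dsl y ∈ K)
    (hr1 : ∀ y, ‖iteratedFDeriv ℝ 1 (stressCL c Rsl Dsl) y‖ ≤ 2 * μ)
    (hσ : HasEnvelope σℓ 1 Aσ μ) (hdσ : HasEnvelope dσ 1 Adσ μ) (hdA : HasEnvelope dA 1 AdA μ)
    (hdR : HasEnvelope dR 1 AdR μ) :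
    HasEnvelope (fun x : ℝ³ =>
      dσ x • (ContinuousLinearMap.apply ℝ ℝ³ (mikadoLiftCL V (stressCL c Rsl Dsl x, n • (x + lift Dsl x))))
          (transposeCL (gradPhiCL Dsl x)) +
        σℓ x • ((ContinuousLinearMap.apply ℝ ℝ³ (mikadoLiftCL V (stressCL c Rsl Dsl x, n • (x + lift Dsl x))))
            (transposeCL (matCLM (dA x))) +
          (ContinuousLinearMap.apply ℝ ℝ³
            ((ContinuousLinearMap.apply ℝ ℝ³ (((ContinuousLinearMap.inl ℝ 𝕃 ℝ³).comp matCLM) (dR x)))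
              (fderiv ℝ (mikadoLiftCL V) (stressCL c Rsl Dsl x, n • (x + lift Dsl x)))))
            (transposeCL (gradPhiCL Dsl x)))) 1
      (32 * ‖transposeCL‖ * CV * (1 + ‖matCLM‖ + ‖(ContinuousLinearMap.inl ℝ 𝕃 ℝ³).comp matCLM‖) *
        (Adσ + Aσ * (AdA + AdR))) (2 * μ) := by
  have hμ2 : μ ≤ 2 * μ := by linarith
  have h2μ : 1 ≤ 2 * μ := hμ.trans hμ2
  have hθ : 0 ≤ ‖transposeCL‖ := norm_nonneg transposeCL
  set θ : ℝ := ‖transposeCL‖ with hθdef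
  set Mn : ℝ := ‖matCLM‖ with hMn
  set Ln : ℝ := ‖(ContinuousLinearMap.inl ℝ 𝕃 ℝ³).comp matCLM‖ with hLn
  have hMn0 : 0 ≤ Mn := norm_nonneg matCLM
  have hLn0 : 0 ≤ Ln := norm_nonneg ((ContinuousLinearMap.inl ℝ 𝕃 ℝ³).comp matCLM)
  have hAσ := hσ.nonneg
  have hAdσ := hdσ.nonneg
  have hAdA := hdA.nonneg
  have hAdR := hdR.nonneg
  -- the ingredients
  have hG : HasEnvelope (gradPhiCL Dsl) 1 2 μ := hasEnvelope_gradPhiCL hD hμ hd1 hd2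
  have hAT : HasEnvelope (fun y => transposeCL (gradPhiCL Dsl y)) 1 (θ * 2) (2 * μ) :=
    (hG.clm_comp transposeCL).of_mu_le hμ2
  have hDp : ∀ y, ‖fderiv ℝ (fun z : ℝ³ => (stressCL c Rsl Dsl z, n • (z + lift Dsl z))) y‖ ≤ 2 * μ :=
    norm_fderiv_pairCL_le hR hD hn hd1 hr1
  have hh := hasEnvelope_mikadoLiftCL_comp (c := c) (n := n) hV hCV0 hCV hR hD h2μ hK hDp
  have hh' := hasEnvelope_fderiv_mikadoLiftCL_comp (c := c) (n := n) hV hCV0 hCV hR hD h2μ hK hDp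
  -- `T(G)(V∘p)`
  have hTGV := hh.bilinear (ContinuousLinearMap.apply ℝ ℝ³ (E := ℝ³)) hAT
  -- term 1
  have h1 := (hdσ.of_mu_le hμ2).smul hTGV
  -- `T(dA)(V∘p)`
  have hTdA : HasEnvelope (fun y => transposeCL (matCLM (dA y))) 1 (θ * (Mn * AdA)) (2 * μ) :=
    ((hdA.clm_comp matCLM).clm_comp transposeCL).of_mu_le hμ2
  have hTdAV := hh.bilinear (ContinuousLinearMap.apply ℝ ℝ³ (E := ℝ³)) hTdA
  -- `(dR, 0)` and `DV(p)[(dR,0)]`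
  have hdR' : HasEnvelope (fun y => ((ContinuousLinearMap.inl ℝ 𝕃 ℝ³).comp matCLM) (dR y)) 1 (Ln * AdR) (2 * μ) :=
    (hdR.clm_comp _).of_mu_le hμ2
  have hinner := hdR'.bilinear (ContinuousLinearMap.apply ℝ ℝ³ : (𝕃 × ℝ³) →L[ℝ] ((𝕃 × ℝ³) →L[ℝ] ℝ³) →L[ℝ] ℝ³) hh'
  have hTGi := hinner.bilinear (ContinuousLinearMap.apply ℝ ℝ³ (E := ℝ³)) hAT
  -- terms 2 + 3 and the total
  have h23 := (hσ.of_mu_le hμ2).smul (hTdAV.add hTGi)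
  have htot := h1.add h23
  refine htot.mono le_rfl ?_
  exact dtSummand_amp_arith hθ hCV0 hMn0 hLn0 hAσ hAdσ hAdA hAdR
    (norm_nonneg (ContinuousLinearMap.apply ℝ ℝ³ (E := ℝ³)))
    (norm_nonneg (ContinuousLinearMap.apply ℝ ℝ³ : (𝕃 × ℝ³) →L[ℝ] ((𝕃 × ℝ³) →L[ℝ] ℝ³) →L[ℝ] ℝ³))
    norm_apply_le norm_apply₂_le

end AbstractEnvelope

/-! ## Envelopes of matrix-valued lifts and of the cut-off amplitude -/

section DataEnvelopes

variable {P : Params} {S : Setting} {Nbar : ℕ} {Cin C₀ c₀ : ℝ} {Cη : ℕ → ℕ → ℝ}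

/-- **An order-one envelope for the lift of a matrix field** (viewed in the sup-normed arrays `𝕄π`)
from its `C^{0,0}` and `C^{1,0}` norms. [folklore] -/
theorem hasEnvelope_lift_matrix {g : 𝕋³ → 𝕄} (hg : IsSmooth g) {A B μ : ℝ} (hA : 0 ≤ A) (hμ : 1 ≤ μ)
    (h0 : Torus.eContDiffHolderNorm 0 0 g ≤ ENNReal.ofReal A) (h1 : Torus.eContDiffHolderNorm 1 0 g ≤ ENNReal.ofReal B)
    (hB : B ≤ A * μ) : HasEnvelope (fun y => (lift g y : 𝕄π)) 1 A μ := by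
  have hs : ContDiff ℝ ∞ (fun y => (lift g y : 𝕄π)) := hg
  refine HasEnvelope.of_le_one hs hA hμ (fun y => ?_) (fun y => ?_)
  · have h := norm_iteratedFDeriv_lift_le_of_eContDiffHolderNorm_le h0 (le_refl 0) y
    rw [norm_iteratedFDeriv_zero, max_eq_left hA] at h
    exact h
  · have h := norm_iteratedFDeriv_lift_le_of_eContDiffHolderNorm_le h1 (le_refl 1) y
    have hB' : max B 0 ≤ A * μ := max_le hB (mul_nonneg hA (zero_le_one.trans hμ))
    exact h.trans hB'

/-- The evaluation pairing `(u, L) ↦ L u` on `ℝ³ × (ℝ³ →L ℝ)` has norm at most one. [folklore] -/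
theorem norm_apply_real_le : ‖ContinuousLinearMap.apply ℝ ℝ (E := ℝ³)‖ ≤ 1 := by
  rw [ContinuousLinearMap.apply, ContinuousLinearMap.opNorm_flip]
  exact ContinuousLinearMap.norm_id_le

/-- **The lift of `D_t ρ_{q,i}^{1/2}` in closed form**:
`lift(D_tρ_{q,i}^{1/2}(t)) (y) = θ' η̃(y) + θ (lift(∂ₜη_i(t))(y) + Dη̃(y)[ṽ(y)])` (`η̃ = lift η_i(t)`,
`ṽ = lift v̄_q(t)`). [folklore] -/
theorem lift_advectiveDeriv_sqrtRhoI {η : ℕ → ℝ → 𝕋³ → ℝ} {D : ℕ → ℝ → 𝕋³ → ℝ³} (h : SmoothData P S η D)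
    (i : ℕ) {t : ℝ} (ht : t ∈ Icc 0 S.T) {θ' : ℝ} (hθ : HasDerivWithinAt (thetaFn P S η) θ' (Icc 0 S.T) t) :
    lift (advectiveDeriv S.T S.vbar (sqrtRhoI P S η i) t) = fun y =>
      θ' * lift (η i t) y + thetaFn P S η t *
        (lift (Torus.timeDerivWithin (Icc 0 S.T) (η i) t) y +
          (ContinuousLinearMap.apply ℝ ℝ (lift (S.vbar t) y)) (fderiv ℝ (lift (η i t)) y)) := by
  funext y
  rw [lift_apply, advectiveDeriv_sqrtRhoI h i ht hθ, advectiveDeriv_apply, lift_apply, lift_apply, lift_apply,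
    ContinuousLinearMap.apply_apply, fderiv_lift]

/-- **The order-one envelope of the cut-off amplitude data** `σ = lift ρ_{q,i}^{1/2}(t)` and
`dσ = lift D_tρ_{q,i}^{1/2}(t)`: `(θ, μ)` and `(|θ'| + θ (K'_η τ⁻¹ + 2 A_v K_η), μ)` respectively, where
`θ ≤ (δ_{q+1}/c₀)^{1/2}`, `K_η = max(C(0,2),0)`, `K'_η = max(C(1,0), C(1,1), 0)`, `A_v = |C₀| + |C_in| δ_q^{1/2}λ_q`
(Lemma 5.3 (5.14), (2.19) at `N = 0`, `‖v̄_q‖₀ ≤ C₀`). [cite: BuckmasterEtAl2018, Lemma 5.3 (arXiv (5.14)) and §2.5 (2.19)] -/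
theorem PerturbationData.hasEnvelope_amplitude (H : CoreHypotheses P S Nbar Cin C₀)
    (𝒟 : PerturbationData P S c₀ Cη) (h𝒮 : SmoothData P S 𝒟.cut.η 𝒟.D) (hCin : 0 ≤ Cin) (ha : 1 ≤ P.a)
    {μ : ℝ} (hμ : 1 ≤ μ) (hKμ : max (Cη 0 2) 0 ≤ μ) (i : ℕ) {t : ℝ} (ht : t ∈ Icc 0 S.T) {θ' : ℝ}
    (hθ : HasDerivWithinAt (thetaFn P S 𝒟.cut.η) θ' (Icc 0 S.T) t) :
    HasEnvelope (lift (sqrtRhoI P S 𝒟.cut.η i t)) 1 (|thetaFn P S 𝒟.cut.η t| * 1) μ ∧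
      HasEnvelope (lift (advectiveDeriv S.T S.vbar (sqrtRhoI P S 𝒟.cut.η i) t)) 1
        (|θ'| * 1 + |thetaFn P S 𝒟.cut.η t| *
          (max (max (Cη 1 0) (Cη 1 1)) 0 * (P.τ S.q)⁻¹ +
            ‖ContinuousLinearMap.apply ℝ ℝ (E := ℝ³)‖ * 2 ^ 1 *
              (|C₀| + |Cin| * (Real.sqrt (amp P.β P.a P.b S.q) * freq P.a P.b S.q)) * max (Cη 0 2) 0)) μ := by
  have hT := H.pos_T
  have hU : UniqueDiffOn ℝ (Icc 0 S.T) := uniqueDiffOn_Icc hT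
  have hτ : 0 < P.τ S.q := glueScale_pos ha S.q
  set Kη : ℝ := max (Cη 0 2) 0 with hKη
  set Kη' : ℝ := max (max (Cη 1 0) (Cη 1 1)) 0 with hKη'
  set W : ℝ := Real.sqrt (amp P.β P.a P.b S.q) * freq P.a P.b S.q with hW
  set Av : ℝ := |C₀| + |Cin| * W with hAv
  have hKη0 : 0 ≤ Kη := le_max_right _ _
  have hKη'0 : 0 ≤ Kη' := le_max_right _ _
  have hW0 : 0 ≤ W := mul_nonneg (Real.sqrt_nonneg _) (freq_pos ha _).le
  have hAv0 : 0 ≤ Av := add_nonneg (abs_nonneg _) (mul_nonneg (abs_nonneg _) hW0)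
  have hμ0 : 0 ≤ μ := zero_le_one.trans hμ
  -- ### the cut-off `η̃ = lift η_i(t)`
  have hηs : IsSmooth (𝒟.cut.η i t) := (𝒟.cut.smooth i).isSmooth_slice ht
  have he0 : ∀ y, ‖lift (𝒟.cut.η i t) y‖ ≤ 1 := fun y => by
    rw [lift_apply, Real.norm_eq_abs, abs_of_nonneg (𝒟.cut.nonneg i t _)]; exact 𝒟.cut.le_one i t _
  have he1 : ∀ y, ‖iteratedFDeriv ℝ 1 (lift (𝒟.cut.η i t)) y‖ ≤ Kη := fun y =>
    𝒟.norm_iteratedFDeriv_lift_eta_le i ht (by norm_num) y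
  have he2 : ∀ y, ‖iteratedFDeriv ℝ 2 (lift (𝒟.cut.η i t)) y‖ ≤ Kη * μ := fun y =>
    (𝒟.norm_iteratedFDeriv_lift_eta_le i ht le_rfl y).trans (le_mul_of_one_le_right hKη0 hμ)
  have Eη : HasEnvelope (lift (𝒟.cut.η i t)) 1 1 μ :=
    HasEnvelope.of_le_one hηs zero_le_one hμ he0 fun y => (he1 y).trans (by rw [one_mul]; exact hKμ)
  have EDη : HasEnvelope (fderiv ℝ (lift (𝒟.cut.η i t))) 1 Kη μ :=
    HasEnvelope.fderiv_of_le hηs hKη0 hμ he1 he2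
  -- ### `∂ₜη_i(t)`
  have hdηs : IsSmooth (Torus.timeDerivWithin (Icc 0 S.T) (𝒟.cut.η i) t) :=
    ((𝒟.cut.smooth i).timeDerivWithin hU).isSmooth_slice ht
  have hd0 : ∀ y, ‖lift (Torus.timeDerivWithin (Icc 0 S.T) (𝒟.cut.η i) t) y‖ ≤ Kη' * (P.τ S.q)⁻¹ := by
    intro y
    rw [lift_apply, Real.norm_eq_abs]
    refine (𝒟.abs_timeDerivWithin_eta_le ha i ht _).trans ?_
    exact mul_le_mul_of_nonneg_right (max_le_max_right _ (le_max_left _ _)) (inv_nonneg.2 hτ.le)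
  have hd1 : ∀ y, ‖iteratedFDeriv ℝ 1 (lift (Torus.timeDerivWithin (Icc 0 S.T) (𝒟.cut.η i) t)) y‖ ≤
      Kη' * (P.τ S.q)⁻¹ * μ := by
    intro y
    have h := 𝒟.cut.deriv_le i 1 1 t ht
    simp only [Function.iterate_one, Nat.cast_one] at h
    have h' := norm_iteratedFDeriv_lift_le_of_eContDiffHolderNorm_le h (le_refl 1) y
    refine h'.trans (max_le ?_ (by positivity))
    rw [Real.rpow_neg_one]
    calc Cη 1 1 * (P.τ S.q)⁻¹ ≤ Kη' * (P.τ S.q)⁻¹ :=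
          mul_le_mul_of_nonneg_right ((le_max_right _ _).trans (le_max_left _ _)) (inv_nonneg.2 hτ.le)
      _ ≤ Kη' * (P.τ S.q)⁻¹ * μ := le_mul_of_one_le_right (mul_nonneg hKη'0 (inv_nonneg.2 hτ.le)) hμ
  have Edη : HasEnvelope (lift (Torus.timeDerivWithin (Icc 0 S.T) (𝒟.cut.η i) t)) 1 (Kη' * (P.τ S.q)⁻¹) μ :=
    HasEnvelope.of_le_one hdηs (mul_nonneg hKη'0 (inv_nonneg.2 hτ.le)) hμ hd0 hd1
  -- ### `ṽ = lift v̄_q(t)`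
  have hvs : IsSmooth (S.vbar t) := H.eulerReynolds.smooth_velocity.isSmooth_slice ht
  have hv0 : ∀ y, ‖lift (S.vbar t) y‖ ≤ Av := fun y => by
    rw [lift_apply]
    exact ((H.velocity_sup t ht _).trans (le_abs_self C₀)).trans (le_add_of_nonneg_right (mul_nonneg (abs_nonneg _) hW0))
  have hv1 : ∀ y, ‖iteratedFDeriv ℝ 1 (lift (S.vbar t)) y‖ ≤ Av * μ := by
    intro y
    have h := H.norm_iteratedFDeriv_lift_vbar_le hCin ha (Nat.zero_le _) (le_refl 1) ht y
    simp only [Nat.cast_zero, neg_zero, Real.rpow_zero, mul_one] at h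
    have h2 : Cin * (Real.sqrt (amp P.β P.a P.b S.q) * freq P.a P.b S.q) ≤ Av := by
      rw [hAv, hW]
      exact (mul_le_mul_of_nonneg_right (le_abs_self Cin) hW0).trans (le_add_of_nonneg_left (abs_nonneg _))
    exact (h.trans h2).trans (le_mul_of_one_le_right hAv0 hμ)
  have Ev : HasEnvelope (lift (S.vbar t)) 1 Av μ := HasEnvelope.of_le_one hvs hAv0 hμ hv0 hv1
  -- ### the pairing `Dη̃[ṽ]` and the two amplitudes
  have Epair := Ev.bilinear (ContinuousLinearMap.apply ℝ ℝ (E := ℝ³)) EDη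
  have Eσ : HasEnvelope (lift (sqrtRhoI P S 𝒟.cut.η i t)) 1 (|thetaFn P S 𝒟.cut.η t| * 1) μ := by
    have e : lift (sqrtRhoI P S 𝒟.cut.η i t) = fun y => thetaFn P S 𝒟.cut.η t * lift (𝒟.cut.η i t) y := by
      funext y; rw [lift_apply, lift_apply, sqrtRhoI, thetaFn, mul_comm]
    rw [e]
    exact Eη.const_mul _
  refine ⟨Eσ, ?_⟩
  rw [lift_advectiveDeriv_sqrtRhoI h𝒮 i ht hθ]
  exact (Eη.const_mul θ').add ((Edη.add Epair).const_mul (thetaFn P S 𝒟.cut.η t))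

/-- The constant of the `D_t`-summand envelope: `32 ‖T‖ C_V (1 + ‖matCLM‖ + ‖inl ∘ matCLM‖)`. [folklore] -/
def dtSummandConst (CV : ℝ) : ℝ :=
  32 * ‖transposeCL‖ * CV * (1 + ‖matCLM‖ + ‖(ContinuousLinearMap.inl ℝ 𝕃 ℝ³).comp matCLM‖)

/-- `dtSummandConst C_V ≥ 0` for `C_V ≥ 0`. [folklore] -/
theorem dtSummandConst_nonneg {CV : ℝ} (hCV : 0 ≤ CV) : 0 ≤ dtSummandConst CV := by
  unfold dtSummandConst
  have h1 := norm_nonneg transposeCL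
  have h2 := norm_nonneg matCLM
  have h3 := norm_nonneg ((ContinuousLinearMap.inl ℝ 𝕃 ℝ³).comp matCLM)
  positivity

/-- The frequency of the envelopes: `μ = (2π(32‖T‖ + 3) + max(C(0,2),0) + 1) n_{q+1}` (as in
`DeRosa.PerturbationData.hasEnvelope_slowPart`). [folklore] -/
def envFreq (P : Params) (S : Setting) (Cη : ℕ → ℕ → ℝ) : ℝ :=
  (2 * Real.pi * (32 * ‖transposeCL‖ + 3) + max (Cη 0 2) 0 + 1) * (P.freqNat (S.q + 1) : ℝ)

/-- The amplitude unit of `D_tρ_{q,i}^{1/2}`: `Θ' + (δ_{q+1}/c₀)^{1/2} (K'_η τ⁻¹ + 2 A_v K_η)`. [folklore] -/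
def dSigmaAmp (P : Params) (S : Setting) (Cin C₀ c₀ : ℝ) (Cη : ℕ → ℕ → ℝ) : ℝ :=
  thetaDerivBound P S Cin c₀ Cη + Real.sqrt (amp P.β P.a P.b (S.q + 1) / c₀) *
    (max (max (Cη 1 0) (Cη 1 1)) 0 * (P.τ S.q)⁻¹ +
      2 * (|C₀| + |Cin| * (Real.sqrt (amp P.β P.a P.b S.q) * freq P.a P.b S.q)) * max (Cη 0 2) 0)

/-- `dSigmaAmp ≥ 0` for `C_in ≥ 0`, `a ≥ 1`. [folklore] -/
theorem dSigmaAmp_nonneg (hCin : 0 ≤ Cin) (ha : 1 ≤ P.a) : 0 ≤ dSigmaAmp P S Cin C₀ c₀ Cη := by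
  unfold dSigmaAmp
  have h1 := thetaDerivBound_nonneg (S := S) (c₀ := c₀) (Cη := Cη) hCin ha
  have hτ : 0 < P.τ S.q := glueScale_pos ha S.q
  have hf := (freq_pos (b := P.b) ha S.q).le
  have hK : 0 ≤ max (Cη 0 2) 0 := le_max_right _ _
  have hK' : 0 ≤ max (max (Cη 1 0) (Cη 1 1)) 0 := le_max_right _ _
  positivity

/-- **The order-one envelope of the lift of `D_t` of the `i`-th summand of `Z`, active `i`.**
Under the core hypotheses with `N̄ ≥ 2`, the thresholds of `DeRosa.PerturbationData.hasEnvelope_slowPart`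
(`4δ_{q+2} ≤ δ_{q+1}λ_q^{-α}`, `C_inℓ^{2α} ≤ 1/2400`, `8‖ofCols‖C_inλ_q^αℓ^α ≤ 1`, `ℓ⁻¹λ_{q+1}⁻¹ ≤ 1`), the Mikado
bound `C_V` on the stress ball, and bounds `A_G`, `A_G ℓ⁻¹` (`A_R`, `A_R ℓ⁻¹`) on the `C^{0,0}`, `C^{1,0}` norms of
`D_t∇Φ_i(t)` (`D_tR̃_{q,i}(t)`), at a time `t` with `η_i(t, ·) ≢ 0`:
`lift (D_t summand_i(t))` has the order-one envelope
`(dtSummandConst C_V · (dSigmaAmp + (δ_{q+1}/c₀)^{1/2} (A_G + A_R)), 2 envFreq)`.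
[cite: BuckmasterEtAl2018, §6.1.2 (arXiv (6.6)–(6.7)) with Prop. 5.9, Lemma 5.3, Cor. 5.8 (5.34)] -/
theorem PerturbationData.hasEnvelope_lift_dtSummand (H : CoreHypotheses P S Nbar Cin C₀)
    (𝒟 : PerturbationData P S c₀ Cη) (h𝒮 : SmoothData P S 𝒟.cut.η 𝒟.D) (𝔚 : MikadoDatum mikadoRadius)
    (hNbar : 2 ≤ Nbar) (hc₀ : 0 < c₀) (hCin : 0 ≤ Cin) (ha : 1 ≤ P.a) (hb : 1 ≤ P.b) (hβ : 0 ≤ P.β) (hα : 0 ≤ P.α)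
    (h4 : 4 * amp P.β P.a P.b (S.q + 2) ≤ amp P.β P.a P.b (S.q + 1) * freq P.a P.b S.q ^ (-P.α))
    (hu : Cin * mollScale P.β P.α P.a P.b S.q ^ (2 * P.α) ≤ 1 / 2400)
    (hstr : 8 * ‖ofColsCL‖ * Cin * (freq P.a P.b S.q ^ P.α * mollScale P.β P.α P.a P.b S.q ^ P.α) ≤ 1)
    (h66 : (mollScale P.β P.α P.a P.b S.q)⁻¹ * (freq P.a P.b (S.q + 1))⁻¹ ≤ 1)
    {CV : ℝ} (hCV0 : 0 ≤ CV)
    (hCV : ∀ m ≤ 2, ∀ L ∈ Metric.closedBall (1 : 𝕃) (3 + 4 * ‖transposeCL‖), ∀ ξ : ℝ³,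
      ‖iteratedFDeriv ℝ m (mikadoLiftCL 𝔚.V) (L, ξ)‖ ≤ CV)
    {AG AR : ℝ} (hAG : 0 ≤ AG) (hAR : 0 ≤ AR) {i : ℕ} {t : ℝ} (ht : t ∈ Icc 0 S.T) {x' : 𝕋³}
    (hη : 𝒟.cut.η i t x' ≠ 0)
    (hdA0 : Torus.eContDiffHolderNorm 0 0 (advectiveDeriv S.T S.vbar (gradPhi 𝒟.D i) t) ≤ ENNReal.ofReal AG)
    (hdA1 : Torus.eContDiffHolderNorm 1 0 (advectiveDeriv S.T S.vbar (gradPhi 𝒟.D i) t) ≤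
      ENNReal.ofReal (AG * (mollScale P.β P.α P.a P.b S.q)⁻¹))
    (hdR0 : Torus.eContDiffHolderNorm 0 0 (advectiveDeriv S.T S.vbar (tildeR P S 𝒟.cut.η 𝒟.D i) t) ≤
      ENNReal.ofReal AR)
    (hdR1 : Torus.eContDiffHolderNorm 1 0 (advectiveDeriv S.T S.vbar (tildeR P S 𝒟.cut.η 𝒟.D i) t) ≤
      ENNReal.ofReal (AR * (mollScale P.β P.α P.a P.b S.q)⁻¹)) :
    HasEnvelope (lift (advectiveDeriv S.T S.vbar (potentialSummand P S 𝔚 𝒟.cut.η 𝒟.D i) t)) 1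
      (dtSummandConst CV * (dSigmaAmp P S Cin C₀ c₀ Cη + Real.sqrt (amp P.β P.a P.b (S.q + 1) / c₀) * (AG + AR)))
      (2 * envFreq P S Cη) := by
  have hT := H.pos_T
  have hU : UniqueDiffOn ℝ (Icc 0 S.T) := uniqueDiffOn_Icc hT
  -- names
  set ℓ := mollScale P.β P.α P.a P.b S.q with hℓdef
  set θ : ℝ := ‖transposeCL‖ with hθdef
  set Kη : ℝ := max (Cη 0 2) 0 with hKηdef
  set c : ℝ := etaMass P S 𝒟.cut.η t / rhoQ P S t with hcdef
  set n : ℝ := (P.freqNat (S.q + 1) : ℝ) with hndef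
  set μ : ℝ := (2 * Real.pi * (32 * ‖transposeCL‖ + 3) + max (Cη 0 2) 0 + 1) * n with hμdef
  have hμenv : envFreq P S Cη = μ := rfl
  set σ₀ : ℝ := Real.sqrt (amp P.β P.a P.b (S.q + 1) / c₀) with hσ₀
  have hθ : 0 ≤ θ := norm_nonneg transposeCL
  have hKη : 0 ≤ Kη := le_max_right _ _
  have hℓ : 0 < ℓ := mollScale_pos ha S.q
  have hℓ1 : ℓ ≤ 1 := mollScale_le_one_of_params ha hb hβ hα S.q
  have hℓi : 0 ≤ ℓ⁻¹ := inv_nonneg.2 hℓ.le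
  have hℓi1 : 1 ≤ ℓ⁻¹ := one_le_inv_iff₀.2 ⟨hℓ, hℓ1⟩
  have hσ₀0 : 0 ≤ σ₀ := Real.sqrt_nonneg _
  -- the frequency `n` and `μ`
  have ha0 : 0 < P.a := by linarith
  have hn1 : 1 ≤ n := by
    rw [hndef]
    exact_mod_cast Nat.one_le_iff_ne_zero.2 (Nat.pos_iff_ne_zero.1 (Nat.ceil_pos.2 (Real.rpow_pos_of_pos ha0 _)))
  have hn0 : 0 ≤ n := zero_le_one.trans hn1
  have hfreq : freq P.a P.b (S.q + 1) = 2 * Real.pi * n := P.freq_eq ha0.le (S.q + 1)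
  have hfreqpos : 0 < freq P.a P.b (S.q + 1) := freq_pos ha _
  have hℓn : ℓ⁻¹ ≤ 2 * Real.pi * n := by
    rw [← hfreq]
    have := mul_le_mul_of_nonneg_right h66 hfreqpos.le
    rwa [mul_assoc, inv_mul_cancel₀ hfreqpos.ne', mul_one, one_mul] at this
  obtain ⟨hμ1, -, hℓμ, hASμ, hADμ, hAημ⟩ := corrFreq_mul_bounds Cη hn1 hℓi hℓn
  have hμ0 : 0 ≤ μ := zero_le_one.trans hμ1
  have hμ2 : μ ≤ 2 * μ := by linarith
  have hnμ : |n| ≤ μ := by rw [abs_of_nonneg hn0]; exact (corrFreq_mul_bounds Cη hn1 hℓi hℓn).2.1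
  -- smooth slices
  have hRs : IsSmooth (S.Rbar t) := H.eulerReynolds.smooth_stress.isSmooth_slice ht
  have hDs : IsSmooth (𝒟.D i t) := (𝒟.flow i).smooth.isSmooth_slice ht
  -- the flow
  have hd : ∀ y, ‖iteratedFDeriv ℝ 1 (lift (𝒟.D i t)) y‖ ≤ 1 / 600 ∧
      ‖iteratedFDeriv ℝ 2 (lift (𝒟.D i t)) y‖ ≤ ℓ⁻¹ ∧ ‖iteratedFDeriv ℝ 3 (lift (𝒟.D i t)) y‖ ≤ 2 * ℓ⁻¹ ^ 2 :=
    fun y => 𝒟.norm_iteratedFDeriv_lift_D_le H hNbar hCin ha hb hβ hα hu ht hη y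
  have hd1 : ∀ y, ‖iteratedFDeriv ℝ 1 (lift (𝒟.D i t)) y‖ ≤ 1 := fun y => (hd y).1.trans (by norm_num)
  have hd2 : ∀ y, ‖iteratedFDeriv ℝ 2 (lift (𝒟.D i t)) y‖ ≤ 2 * μ := fun y =>
    (hd y).2.1.trans (hℓμ.trans hμ2)
  -- the stress
  have hcr : ∀ k : ℕ, k ≤ 2 → ∀ y, |c| * ‖ofColsCL‖ * ‖iteratedFDeriv ℝ k (lift (S.Rbar t)) y‖ ≤ ℓ⁻¹ ^ k :=
    fun k hk y => 𝒟.abs_c_mul_norm_iteratedFDeriv_lift_Rbar_le H hCin ha h4 hstr (hk.trans hNbar) ht y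
  have hr0 : ∀ y, |c| * ‖ofColsCL‖ * ‖lift (S.Rbar t) y‖ ≤ 1 := fun y => by
    have := hcr 0 (by norm_num) y
    rwa [norm_iteratedFDeriv_zero, pow_zero] at this
  have hst : ∀ y, ‖iteratedFDeriv ℝ 1 (stressCL c (S.Rbar t) (𝒟.D i t)) y‖ ≤ 32 * θ * ℓ⁻¹ := by
    intro y
    obtain ⟨h1, -⟩ := norm_iteratedFDeriv_stressCL_le c hRs hDs y (hd1 y) (hr0 y)
    have e1 := hcr 1 (by norm_num) y
    have e2 := hcr 2 le_rfl y
    rw [pow_one] at e1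
    obtain ⟨-, f2, f3⟩ := hd y
    obtain ⟨a1, -⟩ := stress_orders_arith (θ := θ) hθ (norm_nonneg _) hℓi f2 f3 e1 e2 hℓμ
    exact h1.trans a1
  have hr1 : ∀ y, ‖iteratedFDeriv ℝ 1 (stressCL c (S.Rbar t) (𝒟.D i t)) y‖ ≤ 2 * μ := fun y =>
    (hst y).trans (hASμ.trans hμ2)
  -- confinement in the carrier
  have hK : ∀ y, stressCL c (S.Rbar t) (𝒟.D i t) y ∈ Metric.closedBall (1 : 𝕃) (3 + 4 * ‖transposeCL‖) := fun y => by
    rw [Metric.mem_closedBall, dist_eq_norm, ← hθdef]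
    refine (norm_stressCL_sub_one_le c (S.Rbar t) (𝒟.D i t) y (hd1 y)).trans ?_
    rw [← hθdef]
    have f1 := (hd y).1
    have g0 := hr0 y
    have hθ1 : 0 ≤ 1 + 2 * θ := by linarith only [hθ]
    have hθ2 : 0 ≤ 2 * (1 + θ) := by linarith only [hθ]
    have k1 := mul_le_mul_of_nonneg_left f1 hθ1
    have k2 := mul_le_mul_of_nonneg_left g0 hθ2
    linarith only [k1, k2, hθ]
  -- the amplitude data
  obtain ⟨θ', hθd, hθ'⟩ := H.hasDerivWithinAt_thetaFn 𝒟 hc₀ hCin ha h4 ht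
  obtain ⟨Eσ, Edσ⟩ := 𝒟.hasEnvelope_amplitude H h𝒮 hCin ha hμ1 hAημ i ht hθd
  -- the transport data
  have hGsm : Torus.IsSmoothSpaceTimeOn (Icc 0 S.T) (advectiveDeriv S.T S.vbar (gradPhi 𝒟.D i)) :=
    ((h𝒮.gradPhi i).timeDerivWithin hU).add (h𝒮.vbar.convect (h𝒮.gradPhi i) hU)
  have hRsm : Torus.IsSmoothSpaceTimeOn (Icc 0 S.T) (advectiveDeriv S.T S.vbar (tildeR P S 𝒟.cut.η 𝒟.D i)) :=
    ((h𝒮.tildeR i).timeDerivWithin hU).add (h𝒮.vbar.convect (h𝒮.tildeR i) hU)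
  have EdA : HasEnvelope (fun y => (lift (advectiveDeriv S.T S.vbar (gradPhi 𝒟.D i) t) y : 𝕄π)) 1 AG μ :=
    hasEnvelope_lift_matrix (hGsm.isSmooth_slice ht) hAG hμ1 hdA0 hdA1 (mul_le_mul_of_nonneg_left hℓμ hAG)
  have EdR : HasEnvelope (fun y => (lift (advectiveDeriv S.T S.vbar (tildeR P S 𝒟.cut.η 𝒟.D i) t) y : 𝕄π)) 1 AR μ :=
    hasEnvelope_lift_matrix (hRsm.isSmooth_slice ht) hAR hμ1 hdR0 hdR1 (mul_le_mul_of_nonneg_left hℓμ hAR)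
  -- the abstract envelope
  have key := hasEnvelope_dtSummandCL (V := 𝔚.V) (c := c) (n := n) (Rsl := S.Rbar t) (Dsl := 𝒟.D i t)
    𝔚.contDiff_mikadoLift_V hCV0 hCV hRs hDs hμ1 hnμ hd1 hd2 hK hr1 Eσ Edσ EdA EdR
  -- identify the function
  have htr : ∀ x, Torus.timeDerivWithin (Icc 0 S.T) (𝒟.D i) t x + Torus.convect (S.vbar t) (𝒟.D i t) x + S.vbar t x = 0 :=
    fun x => (𝒟.flow i).transport t ht x
  have key' := key.of_eq (g := lift (advectiveDeriv S.T S.vbar (potentialSummand P S 𝔚 𝒟.cut.η 𝒟.D i) t)) (by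
    funext y
    rw [lift_advectiveDeriv_potentialSummand h𝒮 𝔚 i ht htr y]
    simp only [ContinuousLinearMap.apply_apply, ContinuousLinearMap.comp_apply, ContinuousLinearMap.inl_apply,
      matCLM_apply]
    rfl)
  rw [hμenv]
  refine key'.mono le_rfl ?_
  -- the amplitude comparison
  have hθt0 : 0 ≤ thetaFn P S 𝒟.cut.η t := Real.sqrt_nonneg _
  have hθt : |thetaFn P S 𝒟.cut.η t| ≤ σ₀ := by
    rw [abs_of_nonneg hθt0, hσ₀]
    exact 𝒟.sqrt_rhoQ_div_etaMass_le H hc₀ ha ht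
  have ha1 : ‖ContinuousLinearMap.apply ℝ ℝ (E := ℝ³)‖ ≤ 1 := norm_apply_real_le
  set W : ℝ := Real.sqrt (amp P.β P.a P.b S.q) * freq P.a P.b S.q with hW
  set Av : ℝ := |C₀| + |Cin| * W with hAv
  set Kη' : ℝ := max (max (Cη 1 0) (Cη 1 1)) 0 with hKη'
  have hW0 : 0 ≤ W := mul_nonneg (Real.sqrt_nonneg _) (freq_pos ha _).le
  have hAv0 : 0 ≤ Av := add_nonneg (abs_nonneg _) (mul_nonneg (abs_nonneg _) hW0)
  have hKη'0 : 0 ≤ Kη' := le_max_right _ _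
  have hτ : 0 < P.τ S.q := glueScale_pos ha S.q
  have hτi : 0 ≤ (P.τ S.q)⁻¹ := inv_nonneg.2 hτ.le
  have hinner : Kη' * (P.τ S.q)⁻¹ + ‖ContinuousLinearMap.apply ℝ ℝ (E := ℝ³)‖ * 2 ^ 1 * Av * Kη ≤
      Kη' * (P.τ S.q)⁻¹ + 2 * Av * Kη := by
    have h : ‖ContinuousLinearMap.apply ℝ ℝ (E := ℝ³)‖ * 2 ^ 1 * Av * Kη ≤ 1 * 2 ^ 1 * Av * Kη := by gcongr
    linarith
  have hinner0 : 0 ≤ Kη' * (P.τ S.q)⁻¹ + 2 * Av * Kη := by positivity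
  have hAdσ : |θ'| * 1 + |thetaFn P S 𝒟.cut.η t| *
      (Kη' * (P.τ S.q)⁻¹ + ‖ContinuousLinearMap.apply ℝ ℝ (E := ℝ³)‖ * 2 ^ 1 * Av * Kη) ≤
      dSigmaAmp P S Cin C₀ c₀ Cη := by
    unfold dSigmaAmp
    rw [← hσ₀, ← hW, ← hAv, ← hKη', ← hKηdef, mul_one]
    exact add_le_add hθ' (mul_le_mul hθt hinner (by positivity) hσ₀0)
  have hsum : |θ'| * 1 + |thetaFn P S 𝒟.cut.η t| *
        (Kη' * (P.τ S.q)⁻¹ + ‖ContinuousLinearMap.apply ℝ ℝ (E := ℝ³)‖ * 2 ^ 1 * Av * Kη) +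
      |thetaFn P S 𝒟.cut.η t| * 1 * (AG + AR) ≤
      dSigmaAmp P S Cin C₀ c₀ Cη + σ₀ * (AG + AR) := by
    refine add_le_add hAdσ ?_
    rw [mul_one]
    exact mul_le_mul_of_nonneg_right hθt (add_nonneg hAG hAR)
  unfold dtSummandConst
  exact mul_le_mul_of_nonneg_left hsum (dtSummandConst_nonneg hCV0)

end DataEnvelopes

end DeRosa

end Literature.Analysis.FluidPDE
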